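import Mathlib
import Summits.Ventures.PercRepro2.Defs
import Summits.Ventures.PercRepro2.Graph
import Summits.Ventures.PercRepro2.DisagreementPinned
import Summits.Ventures.PercRepro2.TypedA3Inactive
import Summits.Ventures.PercRepro2.TypedSpectator
import Summits.Ventures.PercRepro2.TypedSwitchingPrimed
import Summits.Ventures.PercRepro2.TypedSignSpectator
import Summits.Ventures.PercRepro2.OneColourSwitch
import Summits.Ventures.PercRepro2.OneColourSwitchFibre
import Summits.Ventures.PercRepro2.M9PendantFibreSign
import Summits.Ventures.PercRepro2.TypedM9Pendant
import Summits.Ventures.PercRepro2.CutVertexPaths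

/-!
# `m9` at a cut vertex, the MIXED split `{p, r} ∣ {q, s}` (blind cell PercRepro2, p3 g16,
2026-08-27; `proofs/P3-CPNC.md` §13g)

The other way a cut vertex `v` can split the four marks of `m9` two against two: one mark of EACH
pair on each side (`p, r ∈ L ∪ {v}`, `q, s ∈ Rt ∪ {v}`).  Then `m9` is trivial: `p ~_Y q` and
`r ~_Y s` both pass through `v`, so together they give `p ~_Y r`, which the `Y`-separation forbids
— the left set of `m9′` is EMPTY (`m9Left_eq_empty_of_mixed`, on every fibre
`m9LeftF_eq_empty_of_mixed`) and the sign form is `−2 · #m9Right ≤ 0`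
(`m9SignSum_nonpos_of_mixed`, `m9SignSumF_nonpos_of_mixed`); in the typed calculus
`typedCount_m9_connState_of_mixed`.  With `CutVertexM9.lean` / `TypedM9CutVertex.lean` (the same-
pair split, the product formula) every two-against-two split of the marks at a cut vertex is a
theorem.  Own work; std axioms.
-/

namespace Summit.Ventures.PercRepro2

namespace CutVertexM9

open Finset Classical

variable {V : Type*} {E : Type*}
variable {ends : E → Sym2 V} {side : E → Bool} {L : Set V} {v : V} {Rt : Set V}

/-- In the mixed split, `p ~ q` and `r ~ s` together join `p` to `r` (through `v`). -/
lemma conn_pr_of_mixed (h : CutVertex ends side L v Rt) {p q r s : V} (hp : p ∈ L ∨ p = v)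
    (hq : q ∈ Rt ∨ q = v) (hr : r ∈ L ∨ r = v) (hs : s ∈ Rt ∨ s = v) {ω : Config E}
    (hpq : Conn ends ω p q) (hrs : Conn ends ω r s) : Conn ends ω p r := by
  have h1 : Conn ends ω p v := ((conn_cross_iff h hp hq ω).1 hpq).1
  have h2 : Conn ends ω r v := ((conn_cross_iff h hr hs ω).1 hrs).1
  exact conn_trans h1 (conn_symm h2)

/-- The left set of `m9′` is empty in the mixed split. -/
theorem m9Left_eq_empty_of_mixed (h : CutVertex ends side L v Rt) {p q r s : V}
    (hp : p ∈ L ∨ p = v) (hq : q ∈ Rt ∨ q = v) (hr : r ∈ L ∨ r = v) (hs : s ∈ Rt ∨ s = v) :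
    OneColourSwitch.m9Left ends p q r s = ∅ := by
  ext ω
  simp only [OneColourSwitch.m9Left, Set.mem_setOf_eq, Set.mem_empty_iff_false, iff_false]
  rintro ⟨⟨hsepY, _⟩, hpq, hrs⟩
  exact hsepY.1 (conn_pr_of_mixed h hp hq hr hs hpq hrs)

/-- The left set of `m9′` on a fibre is empty in the mixed split. -/
theorem m9LeftF_eq_empty_of_mixed (h : CutVertex ends side L v Rt) {p q r s : V}
    (hp : p ∈ L ∨ p = v) (hq : q ∈ Rt ∨ q = v) (hr : r ∈ L ∨ r = v) (hs : s ∈ Rt ∨ s = v)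
    (F : Set E) (z : Config E) :
    OneColourSwitch.m9LeftF ends F z p q r s = ∅ := by
  ext ω
  simp only [OneColourSwitch.m9LeftF, Set.mem_setOf_eq, Set.mem_empty_iff_false, iff_false]
  rintro ⟨_, ⟨hsepY, _⟩, hpq, hrs⟩
  exact hsepY.1 (conn_pr_of_mixed h hp hq hr hs hpq hrs)

section Sums

variable [Fintype E] [DecidableEq E]

/-- **`m9` in sign form in the mixed split**: `Σ_Sep σ_pq σ_rs = −2 · #m9Right ≤ 0`. -/
theorem m9SignSum_nonpos_of_mixed (h : CutVertex ends side L v Rt) {p q r s : V}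
    (hp : p ∈ L ∨ p = v) (hq : q ∈ Rt ∨ q = v) (hr : r ∈ L ∨ r = v) (hs : s ∈ Rt ∨ s = v) :
    OneColourSwitch.m9SignSum ends p q r s ≤ 0 := by
  rw [OneColourSwitch.m9SignSum_eq, m9Left_eq_empty_of_mixed h hp hq hr hs]
  simp

/-- **`m9` in sign form on every fibre in the mixed split**. -/
theorem m9SignSumF_nonpos_of_mixed (h : CutVertex ends side L v Rt) {p q r s : V}
    (hp : p ∈ L ∨ p = v) (hq : q ∈ Rt ∨ q = v) (hr : r ∈ L ∨ r = v) (hs : s ∈ Rt ∨ s = v)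
    (F : Set E) (z : Config E) :
    OneColourSwitch.m9SignSumF ends F z p q r s ≤ 0 := by
  rw [OneColourSwitch.m9SignSumF_eq, m9LeftF_eq_empty_of_mixed h hp hq hr hs]
  simp

end Sums

end CutVertexM9

namespace OneColourSwitch

open Finset Classical CovForm.PairHarris CovForm.TypedA3

variable {V : Type*} {E : Type*}
variable (ends : E → Sym2 V)

section Bridge

variable [Fintype E] [DecidableEq E]
variable {R : Type*} [Field R] [LinearOrder R] [IsStrictOrderedRing R]

/-- The typed sign count is `≤ 0` in the mixed split at a cut vertex. -/
theorem typedCount_kerSign_connState_nonpos_of_mixed (F : Finset E) (z : Config E)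
    (τ : E → ℕ) (hτ : ∀ e ∈ F, τ e = 1 ∨ τ e = 2) (g : St6 → R) (hg : ∀ t, 0 ≤ g t)
    {side : E → Bool} {L : Set V} {v : V} {Rt : Set V}
    (h : CutVertexM9.CutVertex ends side L v Rt) {p q r s : V}
    (hp : p ∈ L ∨ p = v) (hq : q ∈ Rt ∨ q = v) (hr : r ∈ L ∨ r = v) (hs : s ∈ Rt ∨ s = v) :
    typedCount F z τ (kerSign (connState ends p q r s) g) ≤ 0 := by
  apply typedCount_kerSign_nonpos_of_fibres F z τ hτ _ g hg
  intro x _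
  rw [pinnedCount_signKer_connState, bridge_fibre_sum_eq_cast]
  exact_mod_cast CutVertexM9.m9SignSumF_nonpos_of_mixed h hp hq hr hs
    (↑(specFree F τ x) : Set E) (specPin F z τ x)

/-- **The move `m9` on `(F, z, τ)` in the mixed split at a cut vertex**. -/
theorem typedCount_m9_connState_of_mixed (F : Finset E) (z : Config E) (τ : E → ℕ)
    (hτ : ∀ e ∈ F, τ e = 1 ∨ τ e = 2) (g : St6 → R) (hg : ∀ t, 0 ≤ g t)
    {side : E → Bool} {L : Set V} {v : V} {Rt : Set V}
    (h : CutVertexM9.CutVertex ends side L v Rt) {p q r s : V}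
    (hp : p ∈ L ∨ p = v) (hq : q ∈ Rt ∨ q = v) (hr : r ∈ L ∨ r = v) (hs : s ∈ Rt ∨ s = v) :
    typedCount F z τ (kerM9Src (connState ends p q r s) g) ≤
      typedCount F z τ (kerM9Tgt (connState ends p q r s) g) :=
  (typedCount_m9_iff_sign F z τ _ g).2
    (typedCount_kerSign_connState_nonpos_of_mixed ends F z τ hτ g hg h hp hq hr hs)

end Bridge

end OneColourSwitch

end Summit.Ventures.PercRepro2
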